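import Mathlib
import Summits.Ventures.PercRepro2.Defs
import Summits.Ventures.PercRepro2.Graph
import Summits.Ventures.PercRepro2.DisagreementSum
import Summits.Ventures.PercRepro2.DisagreementPinned
import Summits.Ventures.PercRepro2.TwoCopyBHK

/-!
# Masked typed BHK with nested contractions — the §28(i) target as one statement
(blind cell PercRepro2, mine-1 g24; `proofs/MINE1-J1.md` §28(h)–(i) and §29; the lemma-line
family (MBHK-1.3-nested) / (MBHK-1.4-nested) of ASSIGNMENTS v12.88 — candidate lemma lines, no row)

A **mask** `m : Finset V` is a vertex set whose clique is forced open in one copy of the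
configuration (`m` contracted in that copy): `maskedGraph ends m ω = openGraph ends ω ⊔ cliqueGraph m`,
`MConn ends m ω u v` is `u ↔ v` in it and `mconnEvent ends m u v` the event; `m = ∅` gives back
`Conn` / `connEvent` of `Graph.lean`.

For the roots `l, h` (the cell's `a₁, a₂`), the marks `o, b`, and a pair of masks `(m, m')` — `m` on
the first (red) copy `x`, `m'` on the second (blue) copy `y` — the **masked pair kernel** is

  `pairKernel m m' r s x y = 1_{Q^m}(x) · 1_{Q^{m'}}(y) · (1[b ∈ C^m_r](x) − 1[b ∈ C^{m'}_r](y))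
                              · (1[o ∈ C^m_s](x) − 1[o ∈ C^{m'}_s](y))`,

`Q^m = {l ↮ h}` read with the mask `m`, `r, s ∈ {l, h}` the roots carrying `b` and `o`; the
**side-sign kernel** `sideKernel m m'` is the same with `σ_v = 1[v ∈ C_l] − 1[v ∈ C_h]` in place of
the two membership indicators, and `sideKernel = pairKernel l l + pairKernel h h − pairKernel l h −
pairKernel h l` pointwise (`sideKernel_eq`).

`pinnedCount G z K` (`DisagreementPinned.lean`) is the complementary-pair count
`∑_{x = z off G} K x (flipOn G x)` on the minor `(G, z)`: the weight-free typed two-copy sum at the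
2-profile with `G` the type-1 edges and `z` the pinned types 0 / 2 — red `= x`, blue `= flipOn G x`.

* `NestedSideCount R ends l h o b` — **THE TARGET (TC-A*)**: for every nested pair `m' ⊆ m` of masks
  and every minor, `0 ≤ pinnedCount G z (sideKernel m m')` — «under the uniform 2-colouring with both
  colours avoiding `l ↔ h`, the side signs of `b` and `o` agree more within a colour than across the
  colours when red carries the larger contraction».
* `NestedSameCount` / `NestedCrossCount` — the four components: the same-root counts (`r = s`) are
  `≥ 0` (masked typed BHK 1.3, same cluster) and the different-root counts are `≤ 0` (masked typed
  BHK 1.4, different clusters).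
* `nestedSideCount_of_components`: the four component statements imply the target (linearity of
  `pinnedCount` and `sideKernel_eq`).
* `pairKernel_empty_hl_eq_neg_crossKernel` / `crossCount_of_nestedCrossCount`: with no masks the
  component `(r, s) = (h, l)` is `−crossKernel` of `TwoCopyBHK.lean`, so the `m = m' = ∅` instance of
  `NestedCrossCount` is exactly the cell's `CrossCount` (= (BASE), typed BHK 1.4).

Census (mine-1 g23, `data/mine-1/g23/twocopy/`; engine D292 / D293): on `K₅` all 77 nested mask pairs
× all 3¹⁰ 2-profiles, each of the four component counts (and the four with `a₃` for `o`) has the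
stated sign, 0 violations, while the 112 non-nested pairs fail in 21 / 108 nonzero pairs each — the
chain condition `m' ⊆ m` is the sign boundary; unmasked on all 10,656 connected 6-vertex graphs with
≤ 7 edges two codes two seats. Nothing here is proved beyond the bookkeeping theorems: the three
`Nested…Count` Props are CANDIDATE LEMMA LINES of row 2′TRI-CH ((R-HYP); no row).
-/

namespace Summit.Ventures.PercRepro2

namespace NestedMask

section Masks

variable {V : Type*} {E : Type*}

/-- The clique on the mask `m` (the edges forced open by contracting `m`). -/
def cliqueGraph (m : Finset V) : SimpleGraph V := SimpleGraph.fromRel fun a b => a ∈ m ∧ b ∈ m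

/-- Adjacency in the clique on `m`: two distinct vertices of `m`. -/
lemma cliqueGraph_adj {m : Finset V} {a b : V} :
    (cliqueGraph m).Adj a b ↔ a ≠ b ∧ a ∈ m ∧ b ∈ m := by
  simp only [cliqueGraph, SimpleGraph.fromRel_adj]
  constructor
  · rintro ⟨h, ⟨ha, hb⟩ | ⟨hb, ha⟩⟩ <;> exact ⟨h, ha, hb⟩
  · rintro ⟨h, ha, hb⟩
    exact ⟨h, Or.inl ⟨ha, hb⟩⟩

/-- The empty mask forces nothing. -/
@[simp] lemma cliqueGraph_empty : cliqueGraph (∅ : Finset V) = ⊥ := by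
  ext a b
  simp [cliqueGraph_adj]

/-- The open graph of `ω` with the clique on the mask `m` forced open (`m` contracted). -/
def maskedGraph (ends : E → Sym2 V) (m : Finset V) (ω : Config E) : SimpleGraph V :=
  openGraph ends ω ⊔ cliqueGraph m

/-- With the empty mask the masked graph is the open graph. -/
@[simp] lemma maskedGraph_empty (ends : E → Sym2 V) (ω : Config E) :
    maskedGraph ends ∅ ω = openGraph ends ω := by
  simp [maskedGraph]

/-- The masked graph is monotone in the configuration. -/
lemma maskedGraph_mono {ends : E → Sym2 V} (m : Finset V) {ω ω' : Config E} (h : ω ≤ ω') :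
    maskedGraph ends m ω ≤ maskedGraph ends m ω' :=
  sup_le_sup_right (openGraph_mono h) _

/-- Masked connection `u ↔ v` in the open graph with `m` contracted. -/
def MConn (ends : E → Sym2 V) (m : Finset V) (ω : Config E) (u v : V) : Prop :=
  (maskedGraph ends m ω).Reachable u v

/-- With the empty mask, masked connection is connection. -/
lemma mconn_empty_iff {ends : E → Sym2 V} {ω : Config E} {u v : V} :
    MConn ends ∅ ω u v ↔ Conn ends ω u v := by
  simp only [MConn, Conn, maskedGraph_empty]

/-- Masked connection is monotone in the configuration. -/
lemma mconn_mono {ends : E → Sym2 V} {m : Finset V} {ω ω' : Config E} (h : ω ≤ ω') {u v : V}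
    (huv : MConn ends m ω u v) : MConn ends m ω' u v :=
  huv.mono (maskedGraph_mono m h)

/-- The masked connection event `{u ↔ v with m contracted}`. -/
def mconnEvent (ends : E → Sym2 V) (m : Finset V) (u v : V) : Set (Config E) :=
  {ω | MConn ends m ω u v}

/-- Membership in `mconnEvent`. -/
@[simp] lemma mem_mconnEvent {ends : E → Sym2 V} {m : Finset V} {u v : V} {ω : Config E} :
    ω ∈ mconnEvent ends m u v ↔ MConn ends m ω u v := Iff.rfl

/-- With the empty mask the masked connection event is the connection event. -/
@[simp] lemma mconnEvent_empty (ends : E → Sym2 V) (u v : V) :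
    mconnEvent ends ∅ u v = connEvent ends u v := by
  ext ω
  simp only [mem_mconnEvent, mem_connEvent, mconn_empty_iff]

/-- Masked connection events are increasing. -/
lemma isUpperSet_mconnEvent (ends : E → Sym2 V) (m : Finset V) (u v : V) :
    IsUpperSet (mconnEvent ends m u v) :=
  fun _ _ h hω => mconn_mono h hω

end Masks

section Kernels

variable {V : Type*} {E : Type*} {R : Type*} [CommRing R]

/-- `1_{Q^m}`: the avoidance `l ↮ h` read with the mask `m`. -/
noncomputable def avoidInd (ends : E → Sym2 V) (m : Finset V) (l h : V) (x : Config E) : R :=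
  ((mconnEvent ends m l h)ᶜ).indicator 1 x

/-- `1[v ∈ C_r]`: the membership of `v` in the cluster of the root `r`, read with the mask `m`. -/
noncomputable def memInd (ends : E → Sym2 V) (m : Finset V) (r v : V) (x : Config E) : R :=
  (mconnEvent ends m r v).indicator 1 x

/-- The side sign `σ_v = 1[v ∈ C_l] − 1[v ∈ C_h]` of the mark `v`, read with the mask `m`. -/
noncomputable def sideSign (ends : E → Sym2 V) (m : Finset V) (l h v : V) (x : Config E) : R :=
  memInd ends m l v x - memInd ends m h v x

/-- **The masked pair kernel** with the masks `m` (red copy `x`) and `m'` (blue copy `y`), the roots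
`l, h`, the root `r` carrying the mark `b` and the root `s` carrying the mark `o`:
`1_{Q^m}(x) 1_{Q^{m'}}(y) (1[b ∈ C^m_r](x) − 1[b ∈ C^{m'}_r](y)) (1[o ∈ C^m_s](x) − 1[o ∈ C^{m'}_s](y))`. -/
noncomputable def pairKernel (ends : E → Sym2 V) (m m' : Finset V) (l h r s o b : V)
    (x y : Config E) : R :=
  avoidInd ends m l h x * avoidInd ends m' l h y *
    (memInd ends m r b x - memInd ends m' r b y) * (memInd ends m s o x - memInd ends m' s o y)

/-- **The masked side-sign kernel** (the §28(i) target's summand):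
`1_{Q^m}(x) 1_{Q^{m'}}(y) (σ_b^m(x) − σ_b^{m'}(y)) (σ_o^m(x) − σ_o^{m'}(y))`. -/
noncomputable def sideKernel (ends : E → Sym2 V) (m m' : Finset V) (l h o b : V)
    (x y : Config E) : R :=
  avoidInd ends m l h x * avoidInd ends m' l h y *
    (sideSign ends m l h b x - sideSign ends m' l h b y) *
    (sideSign ends m l h o x - sideSign ends m' l h o y)

/-- The side-sign kernel is the signed sum of the four pair kernels:
`sideKernel = pairKernel l l + pairKernel h h − pairKernel l h − pairKernel h l`. -/
lemma sideKernel_eq (ends : E → Sym2 V) (m m' : Finset V) (l h o b : V) (x y : Config E) :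
    sideKernel (R := R) ends m m' l h o b x y =
      pairKernel ends m m' l h l l o b x y + pairKernel ends m m' l h h h o b x y -
        pairKernel ends m m' l h l h o b x y - pairKernel ends m m' l h h l o b x y := by
  simp only [sideKernel, pairKernel, sideSign]
  ring

/-- With no masks the pair kernel of the roots `(r, s) = (h, l)` is `−crossKernel` of
`TwoCopyBHK.lean`: `crossKernel = 1_Q(x) 1_Q(y) (1_{lo}(x) − 1_{lo}(y)) (1_{hb}(y) − 1_{hb}(x))`. -/
lemma pairKernel_empty_hl_eq_neg_crossKernel (ends : E → Sym2 V) (l h o b : V) (x y : Config E) :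
    pairKernel (R := R) ends ∅ ∅ l h h l o b x y = - crossKernel ends l h o b x y := by
  simp only [pairKernel, crossKernel, avoidInd, memInd, mconnEvent_empty]
  ring

end Kernels

section Counts

variable {V : Type*} {E : Type*} [Fintype E] [DecidableEq E] {R : Type*} [CommRing R]

/-- `pinnedCount` is additive in the kernel. -/
lemma pinnedCount_add (G : Finset E) (z : Config E) (K K' : Config E → Config E → R) :
    pinnedCount G z (fun x y => K x y + K' x y) = pinnedCount G z K + pinnedCount G z K' := by
  unfold pinnedCount
  rw [← Finset.sum_add_distrib]
  refine Finset.sum_congr rfl fun x _ => ?_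
  split_ifs <;> simp

/-- `pinnedCount` respects differences of kernels. -/
lemma pinnedCount_sub (G : Finset E) (z : Config E) (K K' : Config E → Config E → R) :
    pinnedCount G z (fun x y => K x y - K' x y) = pinnedCount G z K - pinnedCount G z K' := by
  unfold pinnedCount
  rw [← Finset.sum_sub_distrib]
  refine Finset.sum_congr rfl fun x _ => ?_
  split_ifs <;> simp

/-- `pinnedCount` respects negation of the kernel. -/
lemma pinnedCount_neg (G : Finset E) (z : Config E) (K : Config E → Config E → R) :
    pinnedCount G z (fun x y => - K x y) = - pinnedCount G z K := by
  unfold pinnedCount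
  rw [← Finset.sum_neg_distrib]
  refine Finset.sum_congr rfl fun x _ => ?_
  split_ifs <;> simp

end Counts

section Props

variable {V : Type*} {E : Type*} [Fintype E] [DecidableEq E]

/-- **(MBHK-1.3-nested), masked typed BHK 1.3 (same cluster)**: for every nested pair of masks
`m' ⊆ m` (`m` on the red copy, `m'` on the blue copy) and every minor `(G, z)`, the complementary-pair
counts of the same-root pair kernels `(r, s) = (l, l)` and `(h, h)` are nonnegative. -/
def NestedSameCount (R : Type*) [CommRing R] [LinearOrder R] (ends : E → Sym2 V) (l h o b : V) :
    Prop :=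
  ∀ (m m' : Finset V), m' ⊆ m → ∀ (G : Finset E) (z : Config E),
    0 ≤ pinnedCount G z (pairKernel (R := R) ends m m' l h l l o b) ∧
    0 ≤ pinnedCount G z (pairKernel (R := R) ends m m' l h h h o b)

/-- **(MBHK-1.4-nested), masked typed BHK 1.4 (different clusters)**: for every nested pair of masks
`m' ⊆ m` and every minor `(G, z)`, the complementary-pair counts of the different-root pair kernels
`(r, s) = (l, h)` and `(h, l)` are nonpositive. With `m = m' = ∅` this is the cell's `CrossCount`
(`crossCount_of_nestedCrossCount`). -/
def NestedCrossCount (R : Type*) [CommRing R] [LinearOrder R] (ends : E → Sym2 V) (l h o b : V) :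
    Prop :=
  ∀ (m m' : Finset V), m' ⊆ m → ∀ (G : Finset E) (z : Config E),
    pinnedCount G z (pairKernel (R := R) ends m m' l h l h o b) ≤ 0 ∧
    pinnedCount G z (pairKernel (R := R) ends m m' l h h l o b) ≤ 0

/-- **THE TARGET (TC-A*) of `MINE1-J1.md` §28(i)** — the nested-mask typed positivity of the
side-sign covariance: for every nested pair of masks `m' ⊆ m` and every minor `(G, z)`,
`0 ≤ ∑_{x = z off G} 1_{Q^m}(x) 1_{Q^{m'}}(x̄) (σ_b^m(x) − σ_b^{m'}(x̄)) (σ_o^m(x) − σ_o^{m'}(x̄))`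
with `x̄ = flipOn G x` the complementary colouring. The BHK-halves `A`, `B` of every chain leaf of
row 2′TRI-CH with one unmarked point are nonnegative combinations of these counts (`o` and `a₃` for
the mark `o`), weighted by the third copy (§28(h)). -/
def NestedSideCount (R : Type*) [CommRing R] [LinearOrder R] (ends : E → Sym2 V) (l h o b : V) :
    Prop :=
  ∀ (m m' : Finset V), m' ⊆ m → ∀ (G : Finset E) (z : Config E),
    0 ≤ pinnedCount G z (sideKernel (R := R) ends m m' l h o b)

variable {R : Type*} [CommRing R] [LinearOrder R] [IsStrictOrderedRing R]

/-- The four component statements imply the target: `sideKernel = pairKernel l l + pairKernel h h −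
pairKernel l h − pairKernel h l` and `pinnedCount` is linear. -/
theorem nestedSideCount_of_components {ends : E → Sym2 V} {l h o b : V}
    (h13 : NestedSameCount R ends l h o b) (h14 : NestedCrossCount R ends l h o b) :
    NestedSideCount R ends l h o b := by
  intro m m' hmm G z
  have e : sideKernel (R := R) ends m m' l h o b = fun x y =>
      (pairKernel ends m m' l h l l o b x y + pairKernel ends m m' l h h h o b x y) -
        (pairKernel ends m m' l h l h o b x y + pairKernel ends m m' l h h l o b x y) := by
    funext x y
    rw [sideKernel_eq]
    ring
  rw [e, pinnedCount_sub, pinnedCount_add, pinnedCount_add]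
  obtain ⟨h1, h2⟩ := h13 m m' hmm G z
  obtain ⟨h3, h4⟩ := h14 m m' hmm G z
  linarith

/-- The `m = m' = ∅` instance of (MBHK-1.4-nested) is the cell's `CrossCount` (= (BASE) of
`TwoCopyBHK.lean`, typed BHK 1.4): the nested-mask family contains the unmasked statement. -/
theorem crossCount_of_nestedCrossCount {ends : E → Sym2 V} {l h o b : V}
    (h14 : NestedCrossCount R ends l h o b) : CrossCount R ends l h o b := by
  intro G z
  have hz := (h14 ∅ ∅ (Finset.Subset.refl _) G z).2
  have e : crossKernel (R := R) ends l h o b = fun x y => - pairKernel ends ∅ ∅ l h h l o b x y := by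
    funext x y
    rw [pairKernel_empty_hl_eq_neg_crossKernel]
    ring
  rw [e, pinnedCount_neg]
  linarith

end Props

end NestedMask

end Summit.Ventures.PercRepro2
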